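import Mathlib
import Literature.Computability.MetaComplexity.UHSParameters
import HarnessLib

/-!
# Thresholds for the structure theorem of symmetric `ΣΠΣ(k)` circuits (elementary arithmetic; ORBIT currency)

Route MonotoneRestoration, crux `OrbitRestorationQP` (stmt-ValiantsHypothesis-18293), line `depth-three-rung`, registered stub
`stub_sigmaPiSigmaKValue` (A_k).  Namespace `Summit.ValiantsHypothesis.ValiantsHypothesis.Theorems.SigmaKThresholds`.  Route-independent;
pure `ℕ` arithmetic.

The structure theorem at level `n` (`…LevelStructureC.structure_level`) needs, for fixed `k` (top fan-in) and `c` (the `p`-bound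
exponent, `D = n^c + c` factors per term): `k·D < C(n, c+2)` (supports of linear factors), and `A·(⌊log₂ n⌋ + 1) ≤ n` for an
explicit `A = A(k,c)` (the dimension condition of `…StableForms.lean`, the rank bound being logarithmic in `D`).  This file proves that
both hold for all large `n`:

* `log_sq_le` — `(⌊log₂ n⌋ + 1)² ≤ 4n` (from the tree's `UHSParam.sq_succ_le`); `linear_log_le` — `4A² ≤ n ⇒ A(⌊log₂ n⌋ + 1) ≤ n`;
* `log_two_mul_pbound_le` — `⌊log₂ (2(n^c + c))⌋ ≤ (2c+1)(⌊log₂ n⌋ + 1)`;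
* `choose_gt_of_le` — `k(n^c + c) < C(n, c+2)` once `n ≥ chooseThreshold k c`;
* `dimBound`, `dimBound_le` — the dimension expression and its eventual bound.

Everything is proved. [folklore]
-/

-- `Summit.ValiantsHypothesis.ValiantsHypothesis.…` is the tree's single-conjunct layout (Sub = Summit).
set_option linter.dupNamespace false

namespace Summit.ValiantsHypothesis.ValiantsHypothesis.Theorems

namespace SigmaKThresholds

/-! ### Logarithms are eventually small -/

/-- `(⌊log₂ n⌋ + 1)² ≤ 4n` for `n ≥ 1`. [folklore] -/
theorem log_sq_le {n : ℕ} (hn : 1 ≤ n) : (Nat.log 2 n + 1) ^ 2 ≤ 4 * n :=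
  (Literature.Computability.MetaComplexity.UHSParam.sq_succ_le _).trans (Nat.mul_le_mul_left 4 (Nat.pow_log_le_self 2 (by omega)))

/-- **`A·(⌊log₂ n⌋ + 1) ≤ n` once `4A² ≤ n`.** [folklore] -/
theorem linear_log_le {A n : ℕ} (hn : 4 * A ^ 2 ≤ n) (hn1 : 1 ≤ n) : A * (Nat.log 2 n + 1) ≤ n := by
  have h1 : (A * (Nat.log 2 n + 1)) ^ 2 ≤ n ^ 2 := by
    calc (A * (Nat.log 2 n + 1)) ^ 2 = A ^ 2 * (Nat.log 2 n + 1) ^ 2 := by ring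
      _ ≤ A ^ 2 * (4 * n) := Nat.mul_le_mul_left _ (log_sq_le hn1)
      _ = (4 * A ^ 2) * n := by ring
      _ ≤ n * n := Nat.mul_le_mul_right _ hn
      _ = n ^ 2 := by ring
  exact (Nat.pow_le_pow_iff_left (by norm_num)).1 h1

/-- `n^c ≤ 2^(c(⌊log₂ n⌋ + 1))`. [folklore] -/
theorem pow_le_two_pow_log (n c : ℕ) : n ^ c ≤ 2 ^ (c * (Nat.log 2 n + 1)) := by
  rw [pow_mul']
  exact Nat.pow_le_pow_left (Nat.lt_pow_succ_log_self (by norm_num) n).le c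

/-- **`⌊log₂ (2(n^c + c))⌋ ≤ (2c+1)(⌊log₂ n⌋ + 1)`.** [folklore] -/
theorem log_two_mul_pbound_le (n c : ℕ) : Nat.log 2 (2 * (n ^ c + c)) ≤ (2 * c + 1) * (Nat.log 2 n + 1) := by
  set L := Nat.log 2 n with hL
  have hc : c + 1 ≤ 2 ^ c := Nat.lt_two_pow_self
  have h1 : 2 * (n ^ c + c) < 2 ^ (c + 2 + c * (L + 1)) := by
    have hn : n ^ c ≤ 2 ^ (c * (L + 1)) := pow_le_two_pow_log n c
    have h0 : 1 ≤ 2 ^ (c * (L + 1)) := Nat.one_le_two_pow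
    calc 2 * (n ^ c + c) ≤ 2 * (2 ^ (c * (L + 1)) + c * 2 ^ (c * (L + 1))) := by nlinarith
      _ = 2 * (c + 1) * 2 ^ (c * (L + 1)) := by ring
      _ ≤ 2 * 2 ^ c * 2 ^ (c * (L + 1)) := Nat.mul_le_mul_right _ (Nat.mul_le_mul_left 2 hc)
      _ = 2 ^ (c + 1 + c * (L + 1)) := by rw [pow_add, pow_add, pow_one]; ring
      _ < 2 ^ (c + 2 + c * (L + 1)) := Nat.pow_lt_pow_right (by norm_num) (by omega)
  have h0 : 2 * (n ^ c + c) ≠ 0 := by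
    rcases Nat.eq_zero_or_pos c with rfl | hc
    · simp
    · omega
  have h2 : Nat.log 2 (2 * (n ^ c + c)) < c + 2 + c * (L + 1) := Nat.log_lt_of_lt_pow h0 h1
  have h3 : c + 1 + c * (L + 1) ≤ (2 * c + 1) * (L + 1) := by nlinarith
  omega

/-! ### Binomial coefficients eventually dominate -/

/-- The threshold beyond which `k(n^c + c) < C(n, c+2)`. [folklore] -/
def chooseThreshold (k c : ℕ) : ℕ := 2 * (c + 1) + k * (c + 2).factorial * 2 ^ c * (c + 1) + 2

/-- **`k(n^c + c) < C(n, c+2)` for `n ≥ chooseThreshold k c`.** [folklore] -/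
theorem choose_gt_of_le {k c n : ℕ} (hn : chooseThreshold k c ≤ n) : k * (n ^ c + c) < n.choose (c + 2) := by
  unfold chooseThreshold at hn
  set M := k * (c + 2).factorial * 2 ^ c * (c + 1) with hM
  -- `(n - c - 1)^(c+2) ≤ (c+2)! · C(n, c+2)`
  have hdesc : (n + 1 - (c + 2)) ^ (c + 2) ≤ (c + 2).factorial * n.choose (c + 2) := by
    rw [← Nat.descFactorial_eq_factorial_mul_choose]; exact Nat.pow_sub_le_descFactorial n (c + 2)
  set t := n + 1 - (c + 2) with ht
  have ht1 : M + 1 ≤ t := by omega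
  have ht2 : n ≤ 2 * t := by omega
  have hn1 : 1 ≤ n := by omega
  -- `n^c ≤ 2^c t^c`
  have hpow : n ^ c ≤ 2 ^ c * t ^ c := by rw [← mul_pow]; exact Nat.pow_le_pow_left ht2 c
  -- `n^c + c ≤ (c+1) n^c`
  have hpc : n ^ c + c ≤ (c + 1) * n ^ c := by
    have : 1 ≤ n ^ c := Nat.one_le_pow _ _ hn1
    nlinarith
  -- main estimate, multiplied through by `(c+2)! 2^c (c+1)`
  have hfac : 0 < (c + 2).factorial := Nat.factorial_pos _
  have key : (c + 2).factorial * (k * (n ^ c + c)) * (2 ^ c * (c + 1)) < (c + 2).factorial * n.choose (c + 2) * (2 ^ c * (c + 1)) := by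
    calc (c + 2).factorial * (k * (n ^ c + c)) * (2 ^ c * (c + 1))
        = M * (n ^ c + c) := by rw [hM]; ring
      _ ≤ M * ((c + 1) * n ^ c) := Nat.mul_le_mul_left _ hpc
      _ ≤ M * ((c + 1) * (2 ^ c * t ^ c)) := Nat.mul_le_mul_left _ (Nat.mul_le_mul_left _ hpow)
      _ = (M * t ^ c) * (2 ^ c * (c + 1)) := by ring
      _ < (t ^ 2 * t ^ c) * (2 ^ c * (c + 1)) := by
          have htc : 0 < t ^ c := pow_pos (by omega) _
          have hMt : M < t ^ 2 := by nlinarith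
          exact Nat.mul_lt_mul_of_lt_of_le (Nat.mul_lt_mul_of_lt_of_le hMt le_rfl htc) le_rfl (by positivity)
      _ = t ^ (c + 2) * (2 ^ c * (c + 1)) := by ring
      _ ≤ (c + 2).factorial * n.choose (c + 2) * (2 ^ c * (c + 1)) := Nat.mul_le_mul_right _ hdesc
  have := Nat.lt_of_mul_lt_mul_right key
  exact Nat.lt_of_mul_lt_mul_left this

/-! ### The dimension expression -/

/-- The rank-bound constant used at level `n`: `3(2k)²((2c+1)(⌊log₂ n⌋ + 1) + 1)` dominates `3(2m)²(⌊log₂ 2D⌋ + 1)` for `m ≤ k`,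
`D = n^c + c`. [folklore] -/
def rbBound (k c n : ℕ) : ℕ := 3 * (2 * k) ^ 2 * ((2 * c + 1) * (Nat.log 2 n + 1) + 1)

/-- `3(2m)²(⌊log₂ 2(n^c+c)⌋ + 1) ≤ rbBound k c n` for `m ≤ k`. [folklore] -/
theorem rb_le_rbBound {m k : ℕ} (hm : m ≤ k) (c n : ℕ) :
    3 * (2 * m) ^ 2 * (Nat.log 2 (2 * (n ^ c + c)) + 1) ≤ rbBound k c n := by
  unfold rbBound
  exact Nat.mul_le_mul (Nat.mul_le_mul_left _ (Nat.pow_le_pow_left (Nat.mul_le_mul_left 2 hm) 2))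
    (Nat.add_le_add_right (log_two_mul_pbound_le n c) 1)

/-- The dimension expression at level `n`: `4k(1 + k²·(k-1)·(2k+2)^(k²)·(rbBound + 1)) + 8`. [folklore] -/
def dimBound (k c n : ℕ) : ℕ := 4 * (k * (1 + k ^ 2 * ((k - 1) * ((2 * k + 2) ^ (k ^ 2) * (rbBound k c n + 1))))) + 8

/-- The constant `A(k,c)` with `dimBound k c n ≤ A(k,c)·(⌊log₂ n⌋ + 1)`. [folklore] -/
def dimConst (k c : ℕ) : ℕ := 4 * (k * (1 + k ^ 2 * ((k - 1) * ((2 * k + 2) ^ (k ^ 2) * (3 * (2 * k) ^ 2 * (2 * c + 2) + 1))))) + 8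

/-- `dimBound k c n ≤ dimConst k c · (⌊log₂ n⌋ + 1)`. [folklore] -/
theorem dimBound_le_dimConst_mul (k c n : ℕ) : dimBound k c n ≤ dimConst k c * (Nat.log 2 n + 1) := by
  unfold dimBound dimConst rbBound
  set L := Nat.log 2 n + 1 with hL
  have hL1 : 1 ≤ L := by omega
  have h1 : 3 * (2 * k) ^ 2 * ((2 * c + 1) * L + 1) + 1 ≤ (3 * (2 * k) ^ 2 * (2 * c + 2) + 1) * L := by nlinarith
  set P := (2 * k + 2) ^ (k ^ 2) with hP
  set Q := 3 * (2 * k) ^ 2 * (2 * c + 2) + 1 with hQ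
  calc 4 * (k * (1 + k ^ 2 * ((k - 1) * (P * (3 * (2 * k) ^ 2 * ((2 * c + 1) * L + 1) + 1))))) + 8
      ≤ 4 * (k * (1 + k ^ 2 * ((k - 1) * (P * (Q * L))))) + 8 := by gcongr
    _ ≤ 4 * (k * (L + k ^ 2 * ((k - 1) * (P * (Q * L))))) + 8 * L := by (gcongr; omega)
    _ = (4 * (k * (1 + k ^ 2 * ((k - 1) * (P * Q)))) + 8) * L := by ring

/-- **The dimension condition holds for large `n`**: `dimBound k c n ≤ n` once `4·dimConst² ≤ n`. [folklore] -/
theorem dimBound_le {k c n : ℕ} (hn : 4 * dimConst k c ^ 2 ≤ n) : dimBound k c n ≤ n := by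
  have hd : 1 ≤ dimConst k c := by unfold dimConst; omega
  have hn1 : 1 ≤ n := by nlinarith
  exact (dimBound_le_dimConst_mul k c n).trans (linear_log_le hn hn1)

/-- The level threshold: beyond it every numerical side condition of the structure theorem holds. [folklore] -/
def levelThreshold (k c : ℕ) : ℕ := max (max (chooseThreshold k c) (4 * dimConst k c ^ 2)) (max (k + 9) (4 * (c + 2) + c + 7))

/-- **All side conditions beyond the threshold.** [folklore] -/
theorem conditions_of_le {k c n : ℕ} (hn : levelThreshold k c ≤ n) :
    8 < n ∧ k < n ∧ 4 * (c + 2) ≤ n ∧ c + 7 ≤ n ∧ k * (n ^ c + c) < n.choose (c + 2) ∧ dimBound k c n ≤ n := by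
  unfold levelThreshold at hn
  simp only [max_le_iff] at hn
  obtain ⟨⟨h1, h2⟩, h3, h4⟩ := hn
  exact ⟨by omega, by omega, by omega, by omega, choose_gt_of_le h1, dimBound_le h2⟩

end SigmaKThresholds

end Summit.ValiantsHypothesis.ValiantsHypothesis.Theorems
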